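import Mathlib
import Literature.Geometry.Symplectic.StandardEnd
import Literature.Topology.FourManifolds.HomotopySpheres
import Literature.Topology.FourManifolds.CorkTwist
import Literature.Topology.FourManifolds.LickorishTwistSurgery
import Summits.SmoothPoincare4.SmoothPoincare4.Theses.SymplecticOrigami

/-!
# Sketch (crux-ideate, ideator 2, round 1) — first lemmas for crux `OrigamiFoldExistence`
(stmt-SmoothPoincare4-7844, route SymplecticOrigami)

Crux ideas of ideator 2, one checkable first lemma each (plus the dynamical criterion of idea 1);
idea 2 was self-refuted before filing (see NOTES.md) but its lemma is kept as a true statement: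

* idea `liouville-visible-rim`: `VisibleRimStandard`, `ContactTypeSphereBoundsBall`,
  `RimActionCriterion` (McDuff 1987, Thm 5.2, specialised to a 3-sphere in `(ℝ⁴, ω₀)`);
* (dropped idea `contact-cork-twist`: `ContactCorkTwistSphere`);
* idea `shadow-pleats`: `proj5`, `SpunShadowStandard`.

Conventions. `ω₀(a,b) = a₀b₁ − a₁b₀ + a₂b₃ − a₃b₂` is the tree's
`Literature.Geometry.Symplectic.stdSymplecticForm`; `J` is the standard complex structure with
`ω₀(a, b) = ⟪J a, b⟫`; the radial Liouville field of `ω₀` is `½ x` (primitive `λ₀ = ½ ω₀(x, ·)`),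
and every global Liouville field of `ω₀` is `Y_g = ½ x − J ∇g` for a smooth `g : ℝ⁴ → ℝ`
(primitive `λ_g = λ₀ + dg`, since `ω₀(−J∇g, ·) = dg`). Nothing here is proved; every `def … : Prop`
elaborates.
-/

open scoped Manifold ContDiff Topology InnerProductSpace
open Set Function Literature.Geometry.Symplectic Literature.Topology.FourManifolds

noncomputable section

namespace Summit.SmoothPoincare4.SmoothPoincare4.Cruxes.OrigamiFoldExistence.Ideator2

/-- Local notation for `ℝ⁴`. -/
local notation "E4" => EuclideanSpace ℝ (Fin 4)
/-- The round unit `3`-sphere in `ℝ⁴`. -/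
local notation "𝕊³" => (Metric.sphere (0 : EuclideanSpace ℝ (Fin 4)) 1)
/-- The round unit `4`-sphere in `ℝ⁵`. -/
local notation "𝕊⁴" => (Metric.sphere (0 : EuclideanSpace ℝ (Fin 5)) 1)

/-! ### Linear algebra of `(ℝ⁴, ω₀, J)` -/

/-- The standard complex structure `J` on `ℝ⁴ = ℂ²` (`J ∂x₀ = ∂x₁`, `J ∂x₂ = ∂x₃`), chosen so that
`ω₀(a, b) = ⟪J a, b⟫`. -/
def Jrot (a : E4) : E4 :=
  WithLp.toLp 2 ![-(a 1), a 0, -(a 3), a 2]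

/-- The global Liouville vector field `Y_g(x) = ½ x − J ∇g(x)` of `ω₀` attached to a smooth
`g : ℝ⁴ → ℝ` (`ι_{Y_g} ω₀ = λ₀ + dg`, `𝓛_{Y_g} ω₀ = ω₀`); `g = 0` gives the radial field. -/
def liouvilleVec (g : E4 → ℝ) (x : E4) : E4 :=
  (1 / 2 : ℝ) • x - Jrot (gradient g x)

/-- The primitive `λ_g = λ₀ + dg` of `ω₀`, `λ_g(x)(w) = ½ ω₀(x, w) + dg_x(w) = ω₀(Y_g(x), w)`. -/
def liouvilleForm (g : E4 → ℝ) (x w : E4) : ℝ :=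
  (1 / 2 : ℝ) * stdSymplecticForm x w + fderiv ℝ g x w

/-! ### Idea 1 — `liouville-visible-rim` -/

/-- **Visible rim.** For a homotopy 4-sphere `S`, a chart ball `e : ℝ⁴ ↪ S` and a map `G : S → ℝ⁴`
(in the applications an injective immersion of the fake ball `Δ_e = S ∖ e(B̊⁴)`, i.e. an embedding of
`Δ_e` onto a Schoenflies ball `D̄ ⊂ ℝ⁴` with RIM `H = G(e(S³))`): the rim is VISIBLE for the
Hamiltonian shear `g` if the Liouville field `Y_g = ½x − J∇g` is nowhere tangent to `H`, i.e.
`Y_g(G(e u)) ∉ d(G ∘ e)_u (T_u S³)` for every unit `u`. (Then `H` is a hypersurface of restricted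
contact type and — volume growth under the Liouville flow — `Y_g` points OUT of `D̄`, so
`(D̄, ω₀, λ₀ + dg)` is a Liouville domain.) -/
def IsVisibleRim (S : HomotopySphere 4) (e : E4 → S.carrier) (G : S.carrier → E4)
    (g : E4 → ℝ) : Prop :=
  ContDiff ℝ ∞ g ∧ ∀ u : E4, ‖u‖ = 1 →
    liouvilleVec g (G (e u)) ∉ (fderiv ℝ (G ∘ e) u) '' {v : E4 | ⟪v, u⟫_ℝ = 0}

/-- **First lemma of idea 1 (VISIBLE RIM ⇒ STANDARD).** If the fake ball `Δ_e` of a homotopy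
4-sphere `S` admits an injective immersion `G` into `ℝ⁴` (conjunct INV: `S` is invertible,
`S ∖ pt ≅ ℝ⁴`) whose rim is visible for some Hamiltonian shear `g`, then `S ≅ S⁴`.
Chain (all in print): `G(Δ_e) = D̄` is a Liouville domain with boundary `≅ S³` (McDuff–Salamon 2017
Prop. 3.5.31/3.5.33 + volume growth); fillable ⇒ tight (Eliashberg–Gromov 1991) ⇒ `ξ = ξ_std`
(Eliashberg 1992, Thm 2.1.1); exact fillings of `(S³, ξ_std)` are `B⁴` (Gromov 1985 0.3.C; McDuff
1990 Thm 1.7; Eliashberg 1990 Thm 5.1); so `Δ_e ≅ D⁴`, `S` is a twisted sphere, `S ≅ S⁴` (Cerf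
`Γ₄ = 0`, tree `cerf_twistedSphere_four`). -/
def VisibleRimStandard : Prop :=
  ∀ (S : HomotopySphere 4) (e : E4 → S.carrier) (G : S.carrier → E4) (g : E4 → ℝ),
    Manifold.IsSmoothEmbedding (𝓡 4) (𝓡 4) ∞ e →
    (∀ x, x ∉ e '' Metric.ball (0 : E4) 1 → IsLocalDiffeomorphAt (𝓡 4) (𝓡 4) ∞ G x) →
    Set.InjOn G (e '' Metric.ball (0 : E4) 1)ᶜ →
    IsVisibleRim S e G g →
    Nonempty (S.carrier ≃ₘ⟮𝓡 4, 𝓡 4⟯ 𝕊⁴)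

/-- **The same, one level down (ℝ⁴ only): a smooth 3-sphere in `ℝ⁴` of restricted contact type is
unknotted** — it is carried onto the round sphere by a diffeomorphism of `ℝ⁴`, hence bounds a
smooth 4-ball. (McDuff 1990 Thm 1.7 / 1991 + Eliashberg 1992 + Palais' disc theorem.) This is the
Schoenflies conjecture for CONTACT-TYPE spheres, and it is a theorem. -/
def ContactTypeSphereBoundsBall : Prop :=
  ∀ (ι : 𝕊³ → E4) (g : E4 → ℝ), Manifold.IsSmoothEmbedding (𝓡 3) (𝓡 4) ∞ ι → ContDiff ℝ ∞ g →
    (∀ z : 𝕊³, liouvilleVec g (ι z) ∉ Set.range (mfderiv (𝓡 3) (𝓡 4) ι z)) →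
    ∃ Ψ : E4 ≃ₘ⟮𝓡 4, 𝓡 4⟯ E4, Ψ '' (Metric.sphere (0 : E4) 1) = Set.range ι

/-- **The lever of idea 1 as a checkable criterion (McDuff 1987, Thm 5.2, specialised).** Let
`ι : S³ ↪ ℝ⁴` be a smooth embedding with image `H` and `k` a nowhere-zero tangent field along `ι`
spanning the characteristic line field of `H` (`ω₀(k, TH) = 0`). Then `H` is visible for SOME
Hamiltonian shear `g` iff every `k`-invariant probability measure `μ` on `S³` has non-zero action
`∫ ω₀(ι z, k z) dμ = 2 ∫ λ₀(k) dμ` (equivalently, of one sign: the normalised volume measure always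
gives `4·Vol(D̄) / ∫|k| > 0` for `k = Jν`, so the criterion reads "no invariant measure of the rim's
characteristic flow is trapped where the rim faces away from the origin"). `⇒` is Stokes;
`⇐` is McDuff's Hahn–Banach argument on Sullivan's cone of structure currents (every structure
cycle of `k` is a boundary since `H₁(S³; ℝ) = 0`). -/
def RimActionCriterion : Prop :=
  ∀ (ι : 𝕊³ → E4) (k : 𝕊³ → E4), Manifold.IsSmoothEmbedding (𝓡 3) (𝓡 4) ∞ ι →
    ContMDiff (𝓡 3) 𝓘(ℝ, E4) ∞ k →
    (∀ z : 𝕊³, k z ∈ Set.range (mfderiv (𝓡 3) (𝓡 4) ι z) ∧ k z ≠ 0 ∧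
      ∀ w ∈ Set.range (mfderiv (𝓡 3) (𝓡 4) ι z), stdSymplecticForm (k z) w = 0) →
    ((∃ g : E4 → ℝ, ContDiff ℝ ∞ g ∧
        ∀ z : 𝕊³, liouvilleVec g (ι z) ∉ Set.range (mfderiv (𝓡 3) (𝓡 4) ι z)) ↔
      ∀ μ : MeasureTheory.Measure 𝕊³, MeasureTheory.IsProbabilityMeasure μ →
        (∀ f : E4 → ℝ, ContDiff ℝ ∞ f → ∫ z, fderiv ℝ f (ι z) (k z) ∂μ = 0) →
        (∫ z, stdSymplecticForm (ι z) (k z) ∂μ) ≠ 0)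

/-! ### Idea 2 — `contact-cork-twist` -/

/-- `dim ℝ⁵ = 4 + 1`, in the syntactic shape `stereographic' 4` wants. -/
instance factFinrankEuclideanFive : Fact (Module.finrank ℝ (EuclideanSpace ℝ (Fin 5)) = 4 + 1) :=
  ⟨by simp⟩

/-- **First lemma of idea 2 (CONTACT CORK TWISTS OF THE ORIGAMI SPHERE ARE TRIVIAL).**
Let `S⁴ = C ∪_φ W` be a gluing along the boundary in which the compact contractible piece `C` sits,
through the stereographic chart at `p`, inside `ℝ⁴ = S⁴ ∖ {p}` as a LIOUVILLE SUBDOMAIN of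
`(ℝ⁴, ω₀)`: the Liouville field `Y_g = ½x − J∇g` of some Hamiltonian shear `g` is nowhere tangent to
`jC(∂C)` (it then points out of `jC(C)`). Let `τ : ∂C ≅ ∂C` preserve the cooriented contact
structure `ker (λ₀ + dg)|_{∂C}` (sign clause). Then the cork twist `X = C ∪_{φ ∘ τ} W` is
diffeomorphic to `S⁴`.
Chain: glue the Liouville pieces `(jC(C), λ_g)` and `(ℝ⁴ ∖ jC(C̊), λ_g)` along the contactomorphism
(collar/symplectisation gluing); the result is an EXACT symplectic form on `X ∖ pt` equal to `ω₀`
outside a large ball, so the part of `X` inside the round sphere `S³(R)` is an exact filling of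
`(S³, ξ_std)`, hence `≅ B⁴` (McDuff 1990 Thm 1.7 / Eliashberg 1990 Thm 5.1), and `X` is a twisted
sphere, `≅ S⁴` by Cerf. The origami fold data of `S⁴` (fold `= S³(R)`, pieces `ℂP²`) survive the
twist verbatim. -/
def ContactCorkTwistSphere : Prop :=
  ∀ (p : 𝕊⁴) (C : Type) [TopologicalSpace C] [T2Space C] [SecondCountableTopology C]
    [ChartedSpace (EuclideanHalfSpace 4) C] [IsManifold (𝓡∂ 4) ∞ C] [CompactSpace C]
    (bC : BoundaryData (𝓡∂ 4) C (𝓡 3)) (τ : bC.carrier ≃ₘ⟮𝓡 3, 𝓡 3⟯ bC.carrier)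
    (W : Type) [TopologicalSpace W] [ChartedSpace (EuclideanHalfSpace 4) W]
    (bW : BoundaryData (𝓡∂ 4) W (𝓡 3)) (φ : bC.carrier ≃ₘ⟮𝓡 3, 𝓡 3⟯ bW.carrier)
    (jC : C → E4) (jW : W → 𝕊⁴) (g : E4 → ℝ),
    ContractibleSpace C →
    IsBoundaryGluingWith bC bW φ (𝓡 4) ((stereographic' 4 p).symm ∘ jC) jW →
    ContDiff ℝ ∞ g →
    (∀ z : bC.carrier,
      liouvilleVec g (jC (bC.incl z)) ∉ Set.range (mfderiv (𝓡 3) (𝓡 4) (jC ∘ bC.incl) z)) →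
    (∀ (z : bC.carrier) (v : TangentSpace (𝓡 3) z),
      0 < liouvilleForm g (jC (bC.incl (τ z))) (mfderiv (𝓡 3) (𝓡 4) (jC ∘ bC.incl ∘ τ) z v) ↔
        0 < liouvilleForm g (jC (bC.incl z)) (mfderiv (𝓡 3) (𝓡 4) (jC ∘ bC.incl) z v)) →
    ∀ (X : Type) [TopologicalSpace X] [T2Space X] [SecondCountableTopology X]
      [ChartedSpace E4 X] [IsManifold (𝓡 4) ∞ X],
      IsBoundaryGluing bC bW (τ.trans φ) (𝓡 4) X → Nonempty (X ≃ₘ⟮𝓡 4, 𝓡 4⟯ 𝕊⁴)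

/-! ### Idea 3 — `shadow-pleats` (origami gauge of the wrinkled-embedding normal form) -/

/-- Local notation for `ℝ⁵ = ℂ² × ℝ` (coordinates `x₀,…,x₃` of `ℂ²`, height `p 4`). -/
local notation "E5" => EuclideanSpace ℝ (Fin 5)

/-- The vertical projection `ℂ² × ℝ → ℂ²` (forget the height). Its composition with an embedding
`ι : Σ ↪ ℝ⁵` is the SHADOW MAP `φ = proj5 ∘ ι`, and `φ*ω₀ = (dα)|_Σ` for the standard contact form
`α = dh + λ₀` of `ℝ⁵` is Cannas da Silva–Guillemin–Pires' folded form (origami on the round `S⁴`,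
Example 2.3, tree `sphereOrigamiForm`). -/
def proj5 (p : E5) : E4 :=
  WithLp.toLp 2 ![p 0, p 1, p 2, p 3]

/-- **First lemma of idea 3 (rung `p = 0`: SPUN SHADOW ⇒ STANDARD, and the origami form is the
shadow form).** If a smooth closed 4-manifold `M ≃ₕ S⁴` embeds in `ℝ⁵ = ℂ² × ℝ` onto a SPUN SHADOW
`Σ_f = {(x, h) | h² = f(x)}` of a defining function `f` of the closed unit ball (`f ≥ 0` exactly on
the ball, `0` a regular value on the unit sphere), then `M ≅ S⁴`. (`Σ_f ≅ S⁴` by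
`(x, h) ↦ (x, h·(f(x)/(1 − ‖x‖²))^{1/2})`, the ratio being smooth and positive up to the rim; on
`Σ_f` the shadow form `φ*ω₀` is origami with fold the rim `{h = 0}` and Hopf null fibration, so the
fold data of the crux are read off natively, CdGP Prop. 2.8.) The line's complexity is the least
number `p(Σ)` of spherical DOUBLE FOLDS (Eliashberg–Mishachev 2009, §2.10, Thm 3.2 + Remark) that a
round-rim shadow position of `Σ` must carry besides the rim; `p = 0` is this lemma, `p ≤ 1` irons
out, `p = 2` (two pleats unthread) is the first honest rung. -/
def SpunShadowStandard : Prop :=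
  ∀ (M : Type) [TopologicalSpace M] [T2Space M] [SecondCountableTopology M]
    [ChartedSpace E4 M] [IsManifold (𝓡 4) ∞ M] (ι : M → E5) (f : E4 → ℝ),
    ContinuousMap.HomotopyEquiv M 𝕊⁴ → Manifold.IsSmoothEmbedding (𝓡 4) (𝓡 5) ∞ ι → ContDiff ℝ ∞ f →
    (∀ x : E4, 0 ≤ f x ↔ ‖x‖ ≤ 1) → (∀ x : E4, ‖x‖ = 1 → fderiv ℝ f x ≠ 0) →
    Set.range ι = {p : E5 | (p 4) ^ 2 = f (proj5 p)} →
    Nonempty (M ≃ₘ⟮𝓡 4, 𝓡 4⟯ 𝕊⁴)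

/-! ### How any of the lemmas feeds the crux `OrigamiFoldExistence` (transport, pure logic) -/

/-- Fold data are transported along diffeomorphisms and `S⁴` has them (route support item
`RoundSphereIsOrigamiFold`, stmt-SmoothPoincare4-7845); so any line proving `Σ ≅ S⁴` for every
homotopy 4-sphere closes the crux. Recorded as the implication the skeleton stage will prove. -/
def TransportClosesCrux : Prop :=
  Summit.SmoothPoincare4.SmoothPoincare4.Theses.SymplecticOrigami.RoundSphereIsOrigamiFold →
    (∀ S : HomotopySphere 4, Nonempty (S.carrier ≃ₘ⟮𝓡 4, 𝓡 4⟯ 𝕊⁴)) →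
    Summit.SmoothPoincare4.SmoothPoincare4.Theses.SymplecticOrigami.OrigamiFoldExistence

end Summit.SmoothPoincare4.SmoothPoincare4.Cruxes.OrigamiFoldExistence.Ideator2
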